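import Summits.ValiantsHypothesis.ValiantsHypothesis.Theorems.LacunarySymmetroidMatrixDescartesDoorA26WallBubblingWeylQuintHeads
import Summits.ValiantsHypothesis.ValiantsHypothesis.Theorems.LacunarySymmetroidMatrixDescartesDoorA26WallBubblingWeylQuintMinor
import Summits.ValiantsHypothesis.ValiantsHypothesis.Theorems.LacunarySymmetroidMatrixDescartesDoorA26WallBubblingWeylTripleDichotomy

/-!
# Wall bubbling for `DoorA26` — WEYL QUINTUPLES: THE RIGIDITY DICHOTOMY (fifteenth slot alive ⇒ the pure class dies)

HONEST FRAMING.  Chain lemma toward `TripleStratum26` of `Cruxes/DoorA26/Lines/wall_bubbling_ConfluentDoor.lean` (rev 13; crux `DoorA26`,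
stmt-ValiantsHypothesis-19979 — OPEN, typed, never asserted), pattern [5,1] (a QUINTUPLE `δ_1 = … = δ_5`, covered by the «∃ triple» binder).
W1 seat val-sym-door-p2 g15 (#101); the five-letter analogue of #88 `weylTriple_dichotomy` / #94 `weylQuad_dichotomy`, in the size-free frame
language of #92 `…FrameTail`.  Five symmetric letters `V_l : Fin 5 → M₂(ℝ)` with deviations `x_l → 0`: the class `2α` has 25 ordered members,
FIFTEEN function-level slots (`M_0 … M_14`) but only NINE Gram heads (`i + j ≤ 8`, `i, j ≤ 4`), and the frame `T₀..T₄` has a kernel of dimension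
`≥ 2` in the 3-space `Sym₂(ℝ)` (#99 `symm_frame_two_kernel`).

* `exists_subseq_const` — pigeonhole along `ℕ` (a finitely-valued sequence is constant along a subsequence);
* **`weylQuint_dichotomy`** — along a sequence of levels with a scale `N_l > 0` dominating `M_0..M_8` and the mixed pairings `polar(W, T_j)`
  (`j ≤ 4`), it is IMPOSSIBLE that both `M_14/N_l → c₁₄ ≠ 0` (fifteenth slot alive) and `polar(W^a_l, W^b_l)/N_l → d ≠ 0`.  Mechanism: #92 makes
  `M_14 = O(w)·‖G‖` (no head), so `N/‖G‖ → 0`; `M_0..M_8 = O(N)` force the nine head constraints on `β∞ = lim G/‖G‖` (#99 `quintHead_eval`); the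
  two Plücker-normalised kernel vectors survive in the limit; #100 `quint_rigidity_minor` gives an invertible principal `3 × 3` minor, and #85's
  Schur bound `abs_det_mul_polar_le` on that sub-frame kills the pure pairing.

Nothing here bears on `DoorA26`, `MatrixDescartes` (stmt-ValiantsHypothesis-18050) or `VP ≠ VNP`; `TripleStratum26`, (W), (M) OPEN.
`--supports stmt-ValiantsHypothesis-19979 --as helper`.  [this work].
-/

-- `Summit.ValiantsHypothesis.ValiantsHypothesis.…` repeats a component by the D-0017 layout
-- (single-conjunct summit), which the `dupNamespace` linter flags; the name is mandated.
set_option linter.dupNamespace false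

namespace Summit.ValiantsHypothesis.ValiantsHypothesis.Theorems.LacunarySymmetroidMatrixDescartes.WallBubbling

open Finset Filter Topology
open Bubbling (polar polar_apply)
open scoped BigOperators

/-! ## 1. Pigeonhole along a sequence -/

/-- A sequence with values in a finite type is constant along a subsequence. [folklore] -/
theorem exists_subseq_const {α : Type*} [Finite α] (f : ℕ → α) :
    ∃ a : α, ∃ φ : ℕ → ℕ, StrictMono φ ∧ ∀ n, f (φ n) = a := by
  have hfreq : ∃ a, ∃ᶠ n in atTop, f n = a := by
    by_contra hall
    have hev : ∀ᶠ n in atTop, ∀ a, ¬ f n = a :=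
      Filter.eventually_all.2 fun a => Filter.not_frequently.1 (not_exists.1 hall a)
    obtain ⟨n, hn⟩ := hev.exists
    exact hn (f n) rfl
  obtain ⟨a, ha⟩ := hfreq
  obtain ⟨φ, hφ, hφa⟩ := Filter.extraction_of_frequently_atTop ha
  exact ⟨a, φ, hφ, hφa⟩

/-! ## 2. The dichotomy -/

/-- **THE RIGIDITY DICHOTOMY AT A WEYL QUINTUPLE.**  See the module docstring. [this work] -/
theorem weylQuint_dichotomy (V : ℕ → Fin 5 → Matrix (Fin 2) (Fin 2) ℝ) (hV : ∀ l p, (V l p).IsSymm)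
    (x : ℕ → Fin 5 → ℝ) (hx : ∀ p, Tendsto (fun l => x l p) atTop (𝓝 0))
    (Wa Wb : ℕ → Matrix (Fin 2) (Fin 2) ℝ) (hWa : ∀ l, (Wa l).IsSymm) (hWb : ∀ l, (Wb l).IsSymm)
    (N : ℕ → ℝ) (hN : ∀ l, 0 < N l)
    (hhead : ∀ l, ∀ m ≤ 8, |∑ p, ∑ q, polar (V l p) (V l q) * (x l p + x l q) ^ m| ≤ N l)
    (c14 : ℝ) (hc14 : c14 ≠ 0)
    (h14 : Tendsto (fun l => (∑ p, ∑ q, polar (V l p) (V l q) * (x l p + x l q) ^ 14) / N l) atTop (𝓝 c14))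
    (hmixa : ∀ l (m : ℕ), m ≤ 4 → |polar (Wa l) (∑ q, x l q ^ m • V l q)| ≤ N l)
    (hmixb : ∀ l (m : ℕ), m ≤ 4 → |polar (∑ q, x l q ^ m • V l q) (Wb l)| ≤ N l)
    (d : ℝ) (hd : d ≠ 0) (hpure : Tendsto (fun l => polar (Wa l) (Wb l) / N l) atTop (𝓝 d)) : False := by
  classical
  obtain ⟨Ch, hCh0, hCh⟩ := blockMoment_head 5
  -- frame, Gram, moments, deviation size
  set T : ℕ → ℕ → Matrix (Fin 2) (Fin 2) ℝ := fun l i => ∑ q, x l q ^ i • V l q with hT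
  set G : ℕ → Fin 5 × Fin 5 → ℝ := fun l ij => polar (T l ij.1) (T l ij.2) with hG
  set M : ℕ → ℕ → ℝ := fun l m => ∑ p, ∑ q, polar (V l p) (V l q) * (x l p + x l q) ^ m with hM
  set w : ℕ → ℝ := fun l => ∑ p, |x l p| with hw
  have hw0 : ∀ l, 0 ≤ w l := fun l => Finset.sum_nonneg fun p _ => abs_nonneg _
  have hxw : ∀ l p, |x l p| ≤ w l := fun l p => Finset.single_le_sum (f := fun p => |x l p|) (fun _ _ => abs_nonneg _) (Finset.mem_univ p)
  have hwlim : Tendsto w atTop (𝓝 0) := by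
    have := tendsto_finsetSum (Finset.univ : Finset (Fin 5)) fun p _ => (continuous_abs.tendsto _).comp (hx p)
    simpa [hw] using this
  have hTsymm : ∀ l i, (T l i).IsSymm := by
    intro l i
    simp only [hT]
    unfold Matrix.IsSymm
    rw [Matrix.transpose_sum]
    exact Finset.sum_congr rfl fun q _ => by rw [Matrix.transpose_smul, (hV l q)]
  have hGsymm : ∀ l i j, G l (i, j) = G l (j, i) := fun l i j => Bubbling.polar_comm _ _
  -- Step 1: shift to levels with `w ≤ 1/2` and `M_14 ≠ 0`
  obtain ⟨l₀, hl₀⟩ : ∃ l₀, ∀ l, l₀ ≤ l → w l ≤ 1 / 2 ∧ M l 14 ≠ 0 := by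
    obtain ⟨l₁, hl₁⟩ := eventually_ne_zero_of_tendsto h14 hc14
    have hev : ∀ᶠ l in atTop, w l ≤ 1 / 2 := hwlim.eventually (Iic_mem_nhds (by norm_num : (0 : ℝ) < 1 / 2))
    obtain ⟨l₂, hl₂⟩ := eventually_atTop.mp hev
    refine ⟨max l₁ l₂, fun l hl => ⟨hl₂ l (le_of_max_le_right hl), fun h0 => hl₁ l (le_of_max_le_left hl) ?_⟩⟩
    change M l 14 / N l = 0; rw [h0, zero_div]
  -- the Gram scale
  set g : ℕ → ℝ := fun l => (univ : Finset (Fin 5 × Fin 5)).sup' Finset.univ_nonempty (fun ij => |G l ij|) with hg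
  have hdomG : ∀ l ij, |G l ij| ≤ g l := fun l ij => Finset.le_sup' (fun ij => |G l ij|) (Finset.mem_univ ij)
  have hattG : ∀ l, ∃ ij, |G l ij| = g l := by
    intro l
    obtain ⟨ij, _, h⟩ := Finset.exists_mem_eq_sup' (Finset.univ_nonempty (α := Fin 5 × Fin 5)) (fun ij => |G l ij|)
    exact ⟨ij, h.symm⟩
  have hg0 : ∀ l, 0 ≤ g l := fun l => (abs_nonneg _).trans (hdomG l (0, 0))
  have hdomGn : ∀ l (i j : ℕ), i < 5 → j < 5 → |polar (∑ q, x l q ^ i • V l q) (∑ q, x l q ^ j • V l q)| ≤ g l :=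
    fun l i j hi hj => hdomG l (⟨i, hi⟩, ⟨j, hj⟩)
  -- the head decomposition of #92 at every shifted level
  have hhd : ∀ l, l₀ ≤ l → ∀ m, |M l m - ∑ i ∈ (Finset.range (m + 1)).filter (fun i => i < 5 ∧ m - i < 5),
      (m.choose i : ℝ) * polar (T l i) (T l (m - i))| ≤ Ch * 2 ^ m * w l * g l :=
    fun l hl m => hCh (by simp) (V l) (x l) (w l) (hw0 l) (hl₀ l hl).1 (hxw l) (g l) (hg0 l) (hdomGn l) m
  have heads : ∀ l,
      (∑ i ∈ (Finset.range 1).filter (fun i => i < 5 ∧ 0 - i < 5), ((0 : ℕ).choose i : ℝ) * polar (T l i) (T l (0 - i))) = G l (0, 0) ∧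
      (∑ i ∈ (Finset.range 2).filter (fun i => i < 5 ∧ 1 - i < 5), ((1 : ℕ).choose i : ℝ) * polar (T l i) (T l (1 - i))) = 2 * G l (0, 1) ∧
      (∑ i ∈ (Finset.range 3).filter (fun i => i < 5 ∧ 2 - i < 5), ((2 : ℕ).choose i : ℝ) * polar (T l i) (T l (2 - i)))
        = 2 * G l (0, 2) + 2 * G l (1, 1) ∧
      (∑ i ∈ (Finset.range 4).filter (fun i => i < 5 ∧ 3 - i < 5), ((3 : ℕ).choose i : ℝ) * polar (T l i) (T l (3 - i)))
        = 2 * G l (0, 3) + 6 * G l (1, 2) ∧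
      (∑ i ∈ (Finset.range 5).filter (fun i => i < 5 ∧ 4 - i < 5), ((4 : ℕ).choose i : ℝ) * polar (T l i) (T l (4 - i)))
        = 2 * G l (0, 4) + 8 * G l (1, 3) + 6 * G l (2, 2) ∧
      (∑ i ∈ (Finset.range 6).filter (fun i => i < 5 ∧ 5 - i < 5), ((5 : ℕ).choose i : ℝ) * polar (T l i) (T l (5 - i)))
        = 10 * G l (1, 4) + 20 * G l (2, 3) ∧
      (∑ i ∈ (Finset.range 7).filter (fun i => i < 5 ∧ 6 - i < 5), ((6 : ℕ).choose i : ℝ) * polar (T l i) (T l (6 - i)))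
        = 30 * G l (2, 4) + 20 * G l (3, 3) ∧
      (∑ i ∈ (Finset.range 8).filter (fun i => i < 5 ∧ 7 - i < 5), ((7 : ℕ).choose i : ℝ) * polar (T l i) (T l (7 - i))) = 70 * G l (3, 4) ∧
      (∑ i ∈ (Finset.range 9).filter (fun i => i < 5 ∧ 8 - i < 5), ((8 : ℕ).choose i : ℝ) * polar (T l i) (T l (8 - i))) = 70 * G l (4, 4) ∧
      (∑ i ∈ (Finset.range 15).filter (fun i => i < 5 ∧ 14 - i < 5), ((14 : ℕ).choose i : ℝ) * polar (T l i) (T l (14 - i))) = 0 :=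
    fun l => quintHead_eval (fun i j => polar (T l i) (T l j)) (fun i j => Bubbling.polar_comm _ _)
  -- `g > 0` at the shifted levels
  have hgpos : ∀ l, l₀ ≤ l → 0 < g l := by
    intro l hl
    rcases (hg0 l).lt_or_eq with h | h
    · exact h
    · exfalso
      have h14' := hhd l hl 14
      rw [(heads l).2.2.2.2.2.2.2.2.2, sub_zero, ← h, mul_zero] at h14'
      exact (hl₀ l hl).2 (abs_eq_zero.mp (le_antisymm h14' (abs_nonneg _)))
  -- kernel pairs (five letters in a 3-space), their index pairs, and a subsequence with a constant index pair
  have hker := fun l => symm_frame_two_kernel (fun i : Fin 5 => T l i) (fun i => hTsymm l i)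
  choose kc kd hkcle hkdle hidx hkc hkd using hker
  choose I J hI1 hJ0 hI0 hJ1 using hidx
  obtain ⟨⟨I₀, J₀⟩, φ₁, hφ₁, hφ₁IJ⟩ := exists_subseq_const (fun l => (I (l + l₀), J (l + l₀)))
  have hIφ : ∀ l, I (φ₁ l + l₀) = I₀ := fun l => (Prod.mk.inj (hφ₁IJ l)).1
  have hJφ : ∀ l, J (φ₁ l + l₀) = J₀ := fun l => (Prod.mk.inj (hφ₁IJ l)).2
  -- Step 2: extraction for the normalised Gram (along `φ₁ · + l₀`)
  obtain ⟨ψ, hψ, β, hβ, hβle, ⟨ij₁, hij₁⟩⟩ := levelSelection_multi (fun l ij => G (φ₁ l + l₀) ij) (fun l => g (φ₁ l + l₀))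
    (fun l => hgpos _ (Nat.le_add_left _ _)) (fun l ij => hdomG _ ij) (fun l => hattG _)
  -- extraction for the kernel pair
  set u : ℕ → Fin 2 × Fin 5 → ℝ := fun l ik => if ik.1 = 0 then kc (φ₁ (ψ l) + l₀) ik.2 else kd (φ₁ (ψ l) + l₀) ik.2 with hu
  obtain ⟨ψ', hψ', kinf, hkinf, -, -⟩ := levelSelection_multi u (fun _ => (1 : ℝ)) (fun _ => one_pos)
    (fun l ik => by
      simp only [hu]
      split_ifs
      · exact hkcle _ _
      · exact hkdle _ _)
    (fun l => ⟨((0 : Fin 2), I₀), by simp only [hu, if_pos rfl]; rw [← hIφ (ψ l), hI1]; exact abs_one⟩)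
  -- along `σ l = φ₁ (ψ (ψ' l)) + l₀`
  set σ : ℕ → ℕ := fun l => φ₁ (ψ (ψ' l)) + l₀ with hσ
  have hσmono : StrictMono σ := fun a b hab => by simp only [hσ]; exact Nat.add_lt_add_right (hφ₁ (hψ (hψ' hab))) _
  have hσge : ∀ l, l₀ ≤ σ l := fun l => Nat.le_add_left _ _
  have hσtop : Tendsto σ atTop atTop := hσmono.tendsto_atTop
  have hβ' : ∀ ij, Tendsto (fun l => G (σ l) ij / g (σ l)) atTop (𝓝 (β ij)) := fun ij => (hβ ij).comp hψ'.tendsto_atTop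
  have hkc' : ∀ k, Tendsto (fun l => kc (σ l) k) atTop (𝓝 (kinf (0, k))) := fun k => by
    have := hkinf (0, k); simpa [hu] using this
  have hkd' : ∀ k, Tendsto (fun l => kd (σ l) k) atTop (𝓝 (kinf (1, k))) := fun k => by
    have := hkinf (1, k); simpa [hu] using this
  have hw' : Tendsto (fun l => w (σ l)) atTop (𝓝 0) := hwlim.comp hσtop
  have hgσ : ∀ l, 0 < g (σ l) := fun l => hgpos _ (hσge l)
  have hNσ : ∀ l, 0 < N (σ l) := fun l => hN _
  -- the unit minor of the kernel pair survives
  have hcI : kinf (0, I₀) = 1 :=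
    tendsto_nhds_unique (hkc' I₀) (tendsto_const_nhds.congr fun l => by simp only [hσ]; rw [← hIφ (ψ (ψ' l)), hI1])
  have hcJ : kinf (0, J₀) = 0 :=
    tendsto_nhds_unique (hkc' J₀) (tendsto_const_nhds.congr fun l => by simp only [hσ]; rw [← hJφ (ψ (ψ' l)), hJ0])
  have hdI : kinf (1, I₀) = 0 :=
    tendsto_nhds_unique (hkd' I₀) (tendsto_const_nhds.congr fun l => by simp only [hσ]; rw [← hIφ (ψ (ψ' l)), hI0])
  have hdJ : kinf (1, J₀) = 1 :=
    tendsto_nhds_unique (hkd' J₀) (tendsto_const_nhds.congr fun l => by simp only [hσ]; rw [← hJφ (ψ (ψ' l)), hJ1])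
  -- Step 3: `M_14/g → 0`, hence `N/g → 0`
  have hM14g : Tendsto (fun l => M (σ l) 14 / g (σ l)) atTop (𝓝 0) := by
    refine tendsto_zero_of_abs_le_mul (Ch * 2 ^ 14) hw' (Filter.Eventually.of_forall fun l => ?_)
    have h := hhd (σ l) (hσge l) 14
    rw [(heads (σ l)).2.2.2.2.2.2.2.2.2, sub_zero] at h
    rw [abs_div, abs_of_pos (hgσ l), div_le_iff₀ (hgσ l)]
    exact h
  have hNg : Tendsto (fun l => N (σ l) / g (σ l)) atTop (𝓝 0) := by
    have h14σ : Tendsto (fun l => M (σ l) 14 / N (σ l)) atTop (𝓝 c14) := h14.comp hσtop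
    have h := hM14g.div h14σ hc14
    rw [zero_div] at h
    refine h.congr fun l => ?_
    have h1 : M (σ l) 14 ≠ 0 := (hl₀ _ (hσge l)).2
    have h2 : N (σ l) ≠ 0 := ne_of_gt (hNσ l)
    have h3 : g (σ l) ≠ 0 := ne_of_gt (hgσ l)
    simp only [Pi.div_apply]
    field_simp
  -- Step 4: the constraints on `β` from `M_0..M_8 = O(N)`
  have hsmall : ∀ (u : ℕ → ℝ) (C : ℝ), (∀ l, |u l| ≤ C * N (σ l)) → Tendsto (fun l => u l / g (σ l)) atTop (𝓝 0) := by
    intro u C hu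
    refine tendsto_zero_of_abs_le_mul C hNg (Filter.Eventually.of_forall fun l => ?_)
    rw [abs_div, abs_of_pos (hgσ l), div_le_iff₀ (hgσ l)]
    have hg1 : g (σ l) ≠ 0 := ne_of_gt (hgσ l)
    have heq : C * (N (σ l) / g (σ l)) * g (σ l) = C * N (σ l) := by field_simp
    rw [heq]; exact hu l
  have hheadlim : ∀ m, m ≤ 8 → Tendsto (fun l => (∑ i ∈ (Finset.range (m + 1)).filter (fun i => i < 5 ∧ m - i < 5),
      (m.choose i : ℝ) * polar (T (σ l) i) (T (σ l) (m - i))) / g (σ l)) atTop (𝓝 0) := by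
    intro m hm
    have hMg : Tendsto (fun l => M (σ l) m / g (σ l)) atTop (𝓝 0) :=
      hsmall _ 1 fun l => by rw [one_mul]; exact hhead _ m hm
    have hRg : Tendsto (fun l => (M (σ l) m - ∑ i ∈ (Finset.range (m + 1)).filter (fun i => i < 5 ∧ m - i < 5),
        (m.choose i : ℝ) * polar (T (σ l) i) (T (σ l) (m - i))) / g (σ l)) atTop (𝓝 0) := by
      refine tendsto_zero_of_abs_le_mul (Ch * 2 ^ m) hw' (Filter.Eventually.of_forall fun l => ?_)
      rw [abs_div, abs_of_pos (hgσ l), div_le_iff₀ (hgσ l)]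
      exact hhd (σ l) (hσge l) m
    have := hMg.sub hRg
    rw [sub_zero] at this
    exact this.congr fun l => by ring
  have hβ00 : β (0, 0) = 0 := by
    refine tendsto_nhds_unique (hβ' (0, 0)) ?_
    have h := hheadlim 0 (by norm_num)
    exact h.congr fun l => by rw [(heads (σ l)).1]
  have hβ01 : β (0, 1) = 0 := by
    have h := hheadlim 1 (by norm_num)
    have h2 : Tendsto (fun l => G (σ l) (0, 1) / g (σ l)) atTop (𝓝 0) := by
      have := h.const_mul (1 / 2); rw [mul_zero] at this
      exact this.congr fun l => by rw [(heads (σ l)).2.1]; ring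
    exact tendsto_nhds_unique (hβ' (0, 1)) h2
  have hβ0211 : β (0, 2) + β (1, 1) = 0 := by
    have h := hheadlim 2 (by norm_num)
    have h2 : Tendsto (fun l => G (σ l) (0, 2) / g (σ l) + G (σ l) (1, 1) / g (σ l)) atTop (𝓝 0) := by
      have := h.const_mul (1 / 2); rw [mul_zero] at this
      exact this.congr fun l => by rw [(heads (σ l)).2.2.1]; ring
    exact tendsto_nhds_unique ((hβ' (0, 2)).add (hβ' (1, 1))) h2
  have hβ0312 : β (0, 3) + 3 * β (1, 2) = 0 := by
    have h := hheadlim 3 (by norm_num)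
    have h2 : Tendsto (fun l => G (σ l) (0, 3) / g (σ l) + 3 * (G (σ l) (1, 2) / g (σ l))) atTop (𝓝 0) := by
      have := h.const_mul (1 / 2); rw [mul_zero] at this
      exact this.congr fun l => by rw [(heads (σ l)).2.2.2.1]; ring
    exact tendsto_nhds_unique ((hβ' (0, 3)).add ((hβ' (1, 2)).const_mul 3)) h2
  have hβ041322 : β (0, 4) + 4 * β (1, 3) + 3 * β (2, 2) = 0 := by
    have h := hheadlim 4 (by norm_num)
    have h2 : Tendsto (fun l => G (σ l) (0, 4) / g (σ l) + 4 * (G (σ l) (1, 3) / g (σ l)) + 3 * (G (σ l) (2, 2) / g (σ l)))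
        atTop (𝓝 0) := by
      have := h.const_mul (1 / 2); rw [mul_zero] at this
      exact this.congr fun l => by rw [(heads (σ l)).2.2.2.2.1]; ring
    exact tendsto_nhds_unique (((hβ' (0, 4)).add ((hβ' (1, 3)).const_mul 4)).add ((hβ' (2, 2)).const_mul 3)) h2
  have hβ1423 : β (1, 4) + 2 * β (2, 3) = 0 := by
    have h := hheadlim 5 (by norm_num)
    have h2 : Tendsto (fun l => G (σ l) (1, 4) / g (σ l) + 2 * (G (σ l) (2, 3) / g (σ l))) atTop (𝓝 0) := by
      have := h.const_mul (1 / 10); rw [mul_zero] at this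
      exact this.congr fun l => by rw [(heads (σ l)).2.2.2.2.2.1]; ring
    exact tendsto_nhds_unique ((hβ' (1, 4)).add ((hβ' (2, 3)).const_mul 2)) h2
  have hβ2433 : 3 * β (2, 4) + 2 * β (3, 3) = 0 := by
    have h := hheadlim 6 (by norm_num)
    have h2 : Tendsto (fun l => 3 * (G (σ l) (2, 4) / g (σ l)) + 2 * (G (σ l) (3, 3) / g (σ l))) atTop (𝓝 0) := by
      have := h.const_mul (1 / 10); rw [mul_zero] at this
      exact this.congr fun l => by rw [(heads (σ l)).2.2.2.2.2.2.1]; ring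
    exact tendsto_nhds_unique (((hβ' (2, 4)).const_mul 3).add ((hβ' (3, 3)).const_mul 2)) h2
  have hβ34 : β (3, 4) = 0 := by
    have h := hheadlim 7 (by norm_num)
    have h2 : Tendsto (fun l => G (σ l) (3, 4) / g (σ l)) atTop (𝓝 0) := by
      have := h.const_mul (1 / 70); rw [mul_zero] at this
      exact this.congr fun l => by rw [(heads (σ l)).2.2.2.2.2.2.2.1]; ring
    exact tendsto_nhds_unique (hβ' (3, 4)) h2
  have hβ44 : β (4, 4) = 0 := by
    have h := hheadlim 8 (by norm_num)
    have h2 : Tendsto (fun l => G (σ l) (4, 4) / g (σ l)) atTop (𝓝 0) := by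
      have := h.const_mul (1 / 70); rw [mul_zero] at this
      exact this.congr fun l => by rw [(heads (σ l)).2.2.2.2.2.2.2.2.1]; ring
    exact tendsto_nhds_unique (hβ' (4, 4)) h2
  have hβsymm : ∀ i j, β (i, j) = β (j, i) := by
    intro i j
    refine tendsto_nhds_unique (hβ' (i, j)) ((hβ' (j, i)).congr fun l => ?_)
    rw [hGsymm (σ l) j i]
  -- the kernel vectors survive in the limit
  have hkerlim : ∀ (kv : ℕ → Fin 5 → ℝ) (kvinf : Fin 5 → ℝ), (∀ k, Tendsto (fun l => kv (σ l) k) atTop (𝓝 (kvinf k))) →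
      (∀ l (Y : Matrix (Fin 2) (Fin 2) ℝ), ∑ k : Fin 5, kv l k * polar Y (T l k) = 0) → ∀ j : Fin 5, ∑ i : Fin 5, kvinf i * β (j, i) = 0 := by
    intro kv kvinf hkv hrel j
    have hlev : ∀ l, ∑ i : Fin 5, kv (σ l) i * (G (σ l) (j, i) / g (σ l)) = 0 := by
      intro l
      have h := hrel (σ l) (T (σ l) j)
      have : ∑ i : Fin 5, kv (σ l) i * (G (σ l) (j, i) / g (σ l)) = (∑ i : Fin 5, kv (σ l) i * polar (T (σ l) j) (T (σ l) i)) / g (σ l) := by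
        rw [Finset.sum_div]; exact Finset.sum_congr rfl fun i _ => by simp only [hG]; ring
      rw [this, h, zero_div]
    have hlim := tendsto_finsetSum (Finset.univ : Finset (Fin 5)) fun i _ => (hkv i).mul (hβ' (j, i))
    rw [show (fun l => ∑ i : Fin 5, kv (σ l) i * (G (σ l) (j, i) / g (σ l))) = fun _ => (0 : ℝ) from funext hlev] at hlim
    exact tendsto_nhds_unique hlim tendsto_const_nhds
  have hkerc := hkerlim kc (fun k => kinf (0, k)) hkc' (fun l Y => hkc l Y)
  have hkerd := hkerlim kd (fun k => kinf (1, k)) hkd' (fun l Y => hkd l Y)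
  -- Step 5: the common endgame — an invertible principal `3 × 3` minor kills the pure pairing
  have main : ∀ (e : Fin 3 → Fin 5), (Matrix.of fun i j : Fin 3 => β (e i, e j)).det ≠ 0 → False := by
    intro e hdet
    set Bm : ℕ → Matrix (Fin 3) (Fin 3) ℝ := fun l => Matrix.of fun i j : Fin 3 => G (σ l) (e i, e j) / g (σ l) with hBm
    set Binf : Matrix (Fin 3) (Fin 3) ℝ := Matrix.of fun i j : Fin 3 => β (e i, e j) with hBinf
    have hBlim : Tendsto Bm atTop (𝓝 Binf) := by
      refine tendsto_pi_nhds.mpr fun i => tendsto_pi_nhds.mpr fun j => ?_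
      simp only [hBm, hBinf, Matrix.of_apply]
      exact hβ' (e i, e j)
    have hdetlim : Tendsto (fun l => (Bm l).det) atTop (𝓝 Binf.det) := (continuous_id.matrix_det.tendsto Binf).comp hBlim
    obtain ⟨l₁, hl₁⟩ : ∃ l₁, ∀ l, l₁ ≤ l → |Binf.det| / 2 ≤ |(Bm l).det| := by
      have h := (continuous_abs.tendsto _).comp hdetlim
      have hev : ∀ᶠ l in atTop, |Binf.det| / 2 ≤ |(Bm l).det| :=
        h.eventually (Ici_mem_nhds (show |Binf.det| / 2 < |Binf.det| by have := abs_pos.mpr hdet; linarith))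
      exact eventually_atTop.mp hev
    -- the sub-frame
    set T3 : ℕ → Fin 3 → Matrix (Fin 2) (Fin 2) ℝ := fun l i => T (σ l) (e i) with hT3
    have hGmat : ∀ l, (Matrix.of fun i j : Fin 3 => polar (T3 l i) (T3 l j)) = g (σ l) • Bm l := by
      intro l; ext i j
      simp only [hBm, hT3, Matrix.of_apply, Matrix.smul_apply, smul_eq_mul, hG]
      rw [mul_div_cancel₀ _ (ne_of_gt (hgσ l))]
    have hdetG : ∀ l, (Matrix.of fun i j : Fin 3 => polar (T3 l i) (T3 l j)).det = g (σ l) ^ 3 * (Bm l).det := by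
      intro l; rw [hGmat, Matrix.det_smul, Fintype.card_fin]
    have hbound : ∀ l, l₁ ≤ l → |polar (Wa (σ l)) (Wb (σ l))| ≤ 36 / |Binf.det| * (N (σ l) * (N (σ l) / g (σ l))) := by
      intro l hl
      have hrig := abs_det_mul_polar_le (T3 l) (fun i => hTsymm (σ l) (e i)) (Wa (σ l)) (Wb (σ l)) (hWa _) (hWb _)
        (g (σ l)) (N (σ l)) (N (σ l)) (fun k k' => hdomG (σ l) (e k, e k'))
        (fun i => by
          have := hmixa (σ l) (e i : ℕ) (by have := (e i).isLt; omega)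
          simpa [hT3, hT] using this)
        (fun j => by
          have := hmixb (σ l) (e j : ℕ) (by have := (e j).isLt; omega)
          simpa [hT3, hT] using this)
      rw [hdetG, abs_mul, abs_pow, abs_of_pos (hgσ l)] at hrig
      have hgl := hgσ l
      have hdetB : |Binf.det| / 2 ≤ |(Bm l).det| := hl₁ l hl
      have hD0 : 0 < |Binf.det| := abs_pos.mpr hdet
      have h1 : g (σ l) ^ 3 * (|Binf.det| / 2) * |polar (Wa (σ l)) (Wb (σ l))| ≤ 18 * g (σ l) ^ 2 * N (σ l) * N (σ l) := by
        calc g (σ l) ^ 3 * (|Binf.det| / 2) * |polar (Wa (σ l)) (Wb (σ l))|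
            ≤ g (σ l) ^ 3 * |(Bm l).det| * |polar (Wa (σ l)) (Wb (σ l))| := by gcongr
          _ ≤ 18 * g (σ l) ^ 2 * N (σ l) * N (σ l) := hrig
      rw [div_mul_eq_mul_div, le_div_iff₀ hD0]
      have key : |polar (Wa (σ l)) (Wb (σ l))| * |Binf.det| * g (σ l) ≤ 36 * (N (σ l) * N (σ l)) := by
        have hg2 : 0 < g (σ l) ^ 2 := by positivity
        have h1' : g (σ l) ^ 2 * (g (σ l) * (|Binf.det| / 2) * |polar (Wa (σ l)) (Wb (σ l))|)
            ≤ g (σ l) ^ 2 * (18 * N (σ l) * N (σ l)) := by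
          convert h1 using 1 <;> ring
        have h2 := le_of_mul_le_mul_left h1' hg2
        linarith
      calc |polar (Wa (σ l)) (Wb (σ l))| * |Binf.det|
          = (|polar (Wa (σ l)) (Wb (σ l))| * |Binf.det| * g (σ l)) / g (σ l) := by field_simp
        _ ≤ 36 * (N (σ l) * N (σ l)) / g (σ l) := by gcongr
        _ = 36 * (N (σ l) * (N (σ l) / g (σ l))) := by ring
    have hzero : Tendsto (fun l => polar (Wa (σ l)) (Wb (σ l)) / N (σ l)) atTop (𝓝 0) := by
      refine tendsto_zero_of_abs_le_mul (36 / |Binf.det|) hNg (eventually_atTop.mpr ⟨l₁, fun l hl => ?_⟩)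
      rw [abs_div, abs_of_pos (hNσ l), div_le_iff₀ (hNσ l)]
      calc |polar (Wa (σ l)) (Wb (σ l))| ≤ 36 / |Binf.det| * (N (σ l) * (N (σ l) / g (σ l))) := hbound l hl
        _ = 36 / |Binf.det| * (N (σ l) / g (σ l)) * N (σ l) := by ring
    have hdσ : Tendsto (fun l => polar (Wa (σ l)) (Wb (σ l)) / N (σ l)) atTop (𝓝 d) := hpure.comp hσtop
    exact hd (tendsto_nhds_unique hdσ hzero)
  -- Step 6: the invertible principal minor of #100
  have hne : ∃ ij, β ij ≠ 0 := ⟨ij₁, fun h0 => by rw [h0, abs_zero] at hij₁; exact zero_ne_one hij₁⟩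
  obtain ⟨e, he⟩ := quint_rigidity_minor β hβsymm hβ00 hβ01 hβ0211 hβ0312 hβ041322 hβ1423 hβ2433 hβ34 hβ44 hne
    (fun k => kinf (0, k)) (fun k => kinf (1, k)) hkerc hkerd ⟨I₀, J₀, hcI, hcJ, hdI, hdJ⟩
  exact main e he

end Summit.ValiantsHypothesis.ValiantsHypothesis.Theorems.LacunarySymmetroidMatrixDescartes.WallBubbling
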